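import Summits.QuantumFields.YangMills.Theorems.BalabanUVNodesN15KingModelComplexLinkNeumann
import Literature.LinearAlgebra.Matrix.BasicClassesMultiplicity
import Mathlib.LinearAlgebra.Matrix.Charpoly.Eigs
import HarnessLib
/-!
# BalabanUVNodes ∕ N15 — THE KING-MODEL RUNG (PART Ϛ-g): THE SPECTRUM AND THE DETERMINANT ON THE COMPLEX WINDOW — block-Gershgorin: every eigenvalue `λ` of `M_{U,V}` has
# `|λ − D₀| ≤ 2(d+1)(1+ε)c`, so `Re λ ≥ m² − 2(d+1)cε > 0` and `m²−2(d+1)cε ≤ |λ| ≤ m²+2(d+1)c(2+ε)`; over `ℂ` the complex Gaussian normalisation obeys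
# `(m²−2(d+1)cε)^N ≤ |det M_{U,V}| ≤ (m²+2(d+1)c(2+ε))^N`, `N = |T|·|n|`, uniformly in the field
# (Track A, DAG node N15 = NE2; FAN-OUT v1.1 §N15 s3 «KING-MODEL RUNG … + what the curved case adds»; count-neutral)
HONEST FRAMING.  Count-neutral (cell `pub-ymgap`, seat `pub-ymgap-dag-n15-e` g43; `--supports stmt-QuantumFields-27247 --as helper` = K3ᴬ, KEY MAP v3).  One finite torus at fixed
spacing; King's `A = 0` model, FINE covariance layer only; nothing of Bałaban's (3.42) ∕ Thm 3.4 for `G(U)` asserted; nothing continuum ∕ ℝ⁴ ∕ OS ∕ Clay; NOT a node discharge.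
WHAT IS DECIDED.  Off the unitary slice `M_{U,V}` is not normal, so PART Ͱ-c's spectral∕determinant window (`[m², m²+4(d+1)c]`, the BFS diamagnetic inequality) has no Hermitian
proof; this file gives the non-Hermitian substitute on the whole complex window `‖U(b)‖, ‖V(b)‖ ≤ 1+ε`, `2(d+1)cε < m²` ([Balaban1985BackgroundPropagators] Thm 3.4 p.400:
the complexified Gaussian actions `⟨φ̄, Δ_{U′U}φ⟩` whose normalisations `det` enter the densities of §3):
* §1 `fib_mulVec_eq_sum_blk` (`(Av)_x = Σ_yA_{xy}v_y` fibrewise), `norm_toLp_mulVec_le`, ★ `norm_fib_mulVec_le_sum` (`‖(Av)_x‖ ≤ Σ_y‖A_{xy}‖_{op}‖v_y‖`), ★ `norm_fib_cxHop_mulVec_le`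
  (`‖(T_{U,V}v)_x‖ ≤ 2(d+1)(1+ε)c·sup_y‖v_y‖` — the block Schur ∕ `ℓ^∞` bound);
* §2 ★★★ **`norm_D0_sub_eigenvalue_le`** — BLOCK GERSHGORIN: `M_{U,V}v = λv`, `v ≠ 0` ⟹ `|D₀ − λ| ≤ 2(d+1)(1+ε)c`; ★★ `shifted_mass_le_re_eigenvalue` (`Re λ ≥ m²−2(d+1)cε`: the spectrum lies
  in the open RIGHT half-plane — the complexified Gaussian action has positive-definite Hermitian part on eigenvectors), ★★ `shifted_mass_le_norm_eigenvalue`, ★★ `norm_eigenvalue_le`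
  (`|λ| ≤ m²+2(d+1)c(2+ε)`); (roots of the characteristic polynomial are eigenvalues: the tree's `Literature.LinearAlgebra.Matrix.exists_eigenvector_of_isRoot_charpoly`, BY NAME);
* §3 (over `ℂ`; two private multiset helpers) ★★★ **`pow_le_norm_det_cxLapF`** ∕ ★★★ **`norm_det_cxLapF_le_pow`** — THE DETERMINANT
  WINDOW `(m²−2(d+1)cε)^N ≤ |det M_{U,V}| ≤ (m²+2(d+1)c(2+ε))^N`, `N = |T×n|` (`Matrix.det_eq_prod_roots_charpoly`), ★★ `log_norm_det_cxLapF_div_mem` (per degree of freedom: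
  `N⁻¹·log|det M_{U,V}| ∈ [log(m²−2(d+1)cε), log(m²+2(d+1)c(2+ε))]` uniformly in the volume, the fibre and the field).
PRIOR TREE ART (by name): Ϛ-a (`cxLapF`, `cxHop`), Ϛ-b (`l2_opNorm_blk_cxHop_le`, `shifted_D0`, `shifted_mass_pos`, `shifted_weight_nonneg`, `det_cxLapF_ne_zero`), Ͱ-b (`fib`, `fib_apply`),
Ͱ-k (`kingHop`, `sum_kingHop_row`, `kingHop_nonneg`), Ͱ-c (the Hermitian window at unitary `U` — contrast), `Literature.LinearAlgebra.Matrix.BasicClassesMultiplicity` (`exists_eigenvector_of_isRoot_charpoly` [HornJohnson2013 Obs. 1.2.4]), Mathlib (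
`Matrix.det_eq_prod_roots_charpoly`, `Polynomial.Splits.natDegree_eq_card_roots`, `Matrix.charpoly_natDegree_eq_dim`, `Matrix.toEuclideanCLM`, `Finset.exists_max_image`).  Dedup (rg at
filing): basename 0 files; needles `fib_mulVec_eq_sum_blk|norm_D0_sub_eigenvalue_le|norm_det_cxLapF|fib_smul|eq_zero_of_fib_eq_zero` 0 tree files (`norm_toLp_mulVec_le` has homonyms in other namespaces over `ℂ`; ours is the `RCLike` fibre form).  Locators:
[Balaban1985BackgroundPropagators] Thm 3.4 p.400, (3.23) p.394; [King1986] (4.4) p.670, (3.89) p.668; [BrydgesFrohlichSeiler1979] (the unitary-slice determinant inequality, contrast).  0 `sorry`, 0 `def`.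
-/

noncomputable section
open scoped BigOperators ComplexConjugate ComplexOrder Matrix.Norms.L2Operator
open Finset Matrix WithLp

namespace Summit.QuantumFields.YangMills.BalabanUVNodes.N15KingModelRung.Covariant

open Literature.MathematicalPhysics.QuantumFieldTheory.LatticeDiamagneticInequality (Hopping blk)
open Literature.MathematicalPhysics.QuantumFieldTheory.Balaban1983to89.B5Prop11Plancherel (Tor unitVec)
open Literature.MathematicalPhysics.QuantumFieldTheory.King1986.Torus (lapF)

variable {d : ℕ} (K : Fin (d + 1) → ℕ) [hK : ∀ μ, NeZero (K μ)]
variable {𝕜 : Type*} [RCLike 𝕜] {n : Type*} [Fintype n] [DecidableEq n] {c m2 ε : ℝ}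

/-! ## §1 Fibrewise action of a block matrix -/

omit [DecidableEq n] in
/-- `(Av)_x = Σ_y A_{xy}·v_y` fibrewise (as vectors of `EuclideanSpace 𝕜 n`). [folklore] -/
theorem fib_mulVec_eq_sum_blk (A : Matrix (Tor K × n) (Tor K × n) 𝕜) (v : Tor K × n → 𝕜) (x : Tor K) :
    fib K (A *ᵥ v) x = ∑ y, (toLp 2 (blk A x y *ᵥ fun j => v (y, j)) : EuclideanSpace 𝕜 n) := by
  rw [← WithLp.toLp_sum]
  unfold fib
  congr 1
  funext i
  simp only [Finset.sum_apply, Matrix.mulVec, dotProduct, blk, Matrix.of_apply]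
  exact Fintype.sum_prod_type _

omit hK in
/-- `‖Be‖ ≤ ‖B‖_{op}·‖e‖` on `EuclideanSpace 𝕜 n`. [folklore] -/
theorem norm_toLp_mulVec_le (B : Matrix n n 𝕜) (e : n → 𝕜) :
    ‖(toLp 2 (B *ᵥ e) : EuclideanSpace 𝕜 n)‖ ≤ ‖B‖ * ‖(toLp 2 e : EuclideanSpace 𝕜 n)‖ := by
  have h := (Matrix.toEuclideanCLM (n := n) (𝕜 := 𝕜) B).le_opNorm (toLp 2 e)
  rwa [Matrix.toEuclideanCLM_toLp, ← Matrix.cstar_norm_def] at h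

/-- ★ `‖(Av)_x‖ ≤ Σ_y‖A_{xy}‖_{op}·‖v_y‖`. [folklore] -/
theorem norm_fib_mulVec_le_sum (A : Matrix (Tor K × n) (Tor K × n) 𝕜) (v : Tor K × n → 𝕜) (x : Tor K) :
    ‖fib K (A *ᵥ v) x‖ ≤ ∑ y, ‖blk A x y‖ * ‖fib K v y‖ := by
  rw [fib_mulVec_eq_sum_blk]
  exact (norm_sum_le _ _).trans (Finset.sum_le_sum fun y _ => norm_toLp_mulVec_le (blk A x y) _)

/-- ★ THE BLOCK SCHUR ∕ `ℓ^∞` BOUND FOR THE TWO-SIDED HOPPING MATRIX: `‖U(b)‖, ‖V(b)‖ ≤ 1+ε`, `‖v_y‖ ≤ B` for all `y` ⟹ `‖(T_{U,V}v)_x‖ ≤ 2(d+1)(1+ε)c·B` (`c ≥ 0`).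
[cite: Balaban1985BackgroundPropagators, (3.23) p.394; King1986, (4.4) p.670] -/
theorem norm_fib_cxHop_mulVec_le (hc : 0 ≤ c) (hε : 0 ≤ ε) {U V : Tor K × Fin (d + 1) → Matrix n n 𝕜}
    (hU : ∀ b, ‖U b‖ ≤ 1 + ε) (hV : ∀ b, ‖V b‖ ≤ 1 + ε) {v : Tor K × n → 𝕜} {B : ℝ} (hB : ∀ y, ‖fib K v y‖ ≤ B) (x : Tor K) :
    ‖fib K (cxHop K c U V *ᵥ v) x‖ ≤ 2 * ((d : ℝ) + 1) * ((1 + ε) * c) * B := by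
  have hB0 : 0 ≤ B := (norm_nonneg _).trans (hB x)
  refine (norm_fib_mulVec_le_sum K _ v x).trans ?_
  calc ∑ y, ‖blk (cxHop K c U V) x y‖ * ‖fib K v y‖
      ≤ ∑ y, kingHop K ((1 + ε) * c) x y * B :=
        Finset.sum_le_sum fun y _ => mul_le_mul (l2_opNorm_blk_cxHop_le K hc hU hV x y) (hB y) (norm_nonneg _)
          (kingHop_nonneg K (shifted_weight_nonneg hc hε) x y)
    _ = 2 * ((d : ℝ) + 1) * ((1 + ε) * c) * B := by rw [← Finset.sum_mul, sum_kingHop_row]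

/-! ## §2 Block Gershgorin on the window -/

/-- The diagonal part acts as the scalar `D₀`: `M_{U,V}v = D₀·v − T_{U,V}v`. [folklore] -/
theorem cxLapF_mulVec_eq_sub (c m2 : ℝ) (U V : Tor K × Fin (d + 1) → Matrix n n 𝕜) (v : Tor K × n → 𝕜) :
    cxLapF K c m2 U V *ᵥ v = (((m2 + 2 * ((d : ℝ) + 1) * c : ℝ) : 𝕜)) • v - cxHop K c U V *ᵥ v := by
  unfold cxLapF
  rw [Matrix.sub_mulVec]
  congr 1
  funext p
  rw [mulVec_diagonal, Pi.smul_apply, smul_eq_mul]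

omit hK [Fintype n] [DecidableEq n] in
/-- Fibres of a scalar multiple. [folklore] -/
theorem fib_smul (a : 𝕜) (v : Tor K × n → 𝕜) (x : Tor K) : fib K (a • v) x = a • fib K v x := by
  unfold fib
  rw [← WithLp.toLp_smul]
  rfl

omit hK [Fintype n] [DecidableEq n] in
/-- A field all of whose fibres vanish is zero. [folklore] -/
theorem eq_zero_of_fib_eq_zero {v : Tor K × n → 𝕜} (h0 : ∀ y, fib K v y = 0) : v = 0 := by
  funext p
  obtain ⟨y, i⟩ := p
  have h1 := congrArg (fun w : EuclideanSpace 𝕜 n => w i) (h0 y)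
  simpa only [fib_apply, WithLp.ofLp_zero, Pi.zero_apply] using h1

/-- ★★★ **BLOCK GERSHGORIN**: on the window (`c ≥ 0`, `ε ≥ 0`, `‖U(b)‖, ‖V(b)‖ ≤ 1+ε`) every eigenvalue `λ` of `M_{U,V}` lies in the disc `|D₀ − λ| ≤ 2(d+1)(1+ε)c` about the site
weight `D₀ = m²+2(d+1)c` (evaluate `(D₀ − λ)v = T_{U,V}v` at a fibre of maximal norm). [cite: Balaban1985BackgroundPropagators, Thm 3.4 p.400, (3.23) p.394; King1986, (4.4) p.670] -/
theorem norm_D0_sub_eigenvalue_le (hc : 0 ≤ c) (hε : 0 ≤ ε) {U V : Tor K × Fin (d + 1) → Matrix n n 𝕜}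
    (hU : ∀ b, ‖U b‖ ≤ 1 + ε) (hV : ∀ b, ‖V b‖ ≤ 1 + ε) {μ : 𝕜} {v : Tor K × n → 𝕜} (hv : v ≠ 0) (h : cxLapF K c m2 U V *ᵥ v = μ • v) :
    ‖(((m2 + 2 * ((d : ℝ) + 1) * c : ℝ) : 𝕜)) - μ‖ ≤ 2 * ((d : ℝ) + 1) * ((1 + ε) * c) := by
  -- a fibre of maximal norm, which is non-zero
  obtain ⟨x, -, hx⟩ := Finset.exists_max_image Finset.univ (fun y => ‖fib K v y‖) Finset.univ_nonempty
  have hB : ∀ y, ‖fib K v y‖ ≤ ‖fib K v x‖ := fun y => hx y (Finset.mem_univ _)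
  have hpos : 0 < ‖fib K v x‖ := by
    by_contra hle
    exact hv (eq_zero_of_fib_eq_zero K fun y => norm_le_zero_iff.mp ((hB y).trans (not_lt.mp hle)))
  -- `T v = (D₀ − μ)v`
  have hT : cxHop K c U V *ᵥ v = ((((m2 + 2 * ((d : ℝ) + 1) * c : ℝ) : 𝕜)) - μ) • v := by
    have h1 := cxLapF_mulVec_eq_sub K c m2 U V v
    rw [h] at h1
    rw [sub_smul, h1, sub_sub_cancel]
  have hfib : ‖(((m2 + 2 * ((d : ℝ) + 1) * c : ℝ) : 𝕜)) - μ‖ * ‖fib K v x‖ = ‖fib K (cxHop K c U V *ᵥ v) x‖ := by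
    rw [hT, fib_smul, norm_smul]
  have hle : ‖(((m2 + 2 * ((d : ℝ) + 1) * c : ℝ) : 𝕜)) - μ‖ * ‖fib K v x‖ ≤ 2 * ((d : ℝ) + 1) * ((1 + ε) * c) * ‖fib K v x‖ := by
    rw [hfib]; exact norm_fib_cxHop_mulVec_le K hc hε hU hV hB x
  exact le_of_mul_le_mul_right hle hpos

/-- ★★ **THE SPECTRUM LIES IN THE RIGHT HALF-PLANE**: on the window with `2(d+1)cε < m²`, every eigenvalue has `Re λ ≥ m² − 2(d+1)cε > 0`.
[cite: Balaban1985BackgroundPropagators, Thm 3.4 p.400; King1986, (4.4) p.670] -/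
theorem shifted_mass_le_re_eigenvalue (hc : 0 ≤ c) (hε : 0 ≤ ε) {U V : Tor K × Fin (d + 1) → Matrix n n 𝕜}
    (hU : ∀ b, ‖U b‖ ≤ 1 + ε) (hV : ∀ b, ‖V b‖ ≤ 1 + ε) {μ : 𝕜} {v : Tor K × n → 𝕜} (hv : v ≠ 0) (h : cxLapF K c m2 U V *ᵥ v = μ • v) :
    m2 - 2 * ((d : ℝ) + 1) * c * ε ≤ RCLike.re μ := by
  have hG := norm_D0_sub_eigenvalue_le K (m2 := m2) hc hε hU hV hv h
  have hre : RCLike.re ((((m2 + 2 * ((d : ℝ) + 1) * c : ℝ) : 𝕜)) - μ) ≤ 2 * ((d : ℝ) + 1) * ((1 + ε) * c) := (RCLike.re_le_norm _).trans hG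
  rw [map_sub, RCLike.ofReal_re] at hre
  have hD := shifted_D0 (d := d) c m2 ε
  linarith

/-- ★★ **LOWER BOUND ON THE MODULUS OF THE EIGENVALUES**: `|λ| ≥ m² − 2(d+1)cε` on the window. [cite: Balaban1985BackgroundPropagators, Thm 3.4 p.400] -/
theorem shifted_mass_le_norm_eigenvalue (hc : 0 ≤ c) (hε : 0 ≤ ε) {U V : Tor K × Fin (d + 1) → Matrix n n 𝕜}
    (hU : ∀ b, ‖U b‖ ≤ 1 + ε) (hV : ∀ b, ‖V b‖ ≤ 1 + ε) {μ : 𝕜} {v : Tor K × n → 𝕜} (hv : v ≠ 0) (h : cxLapF K c m2 U V *ᵥ v = μ • v) :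
    m2 - 2 * ((d : ℝ) + 1) * c * ε ≤ ‖μ‖ :=
  (shifted_mass_le_re_eigenvalue K hc hε hU hV hv h).trans ((le_abs_self _).trans (RCLike.abs_re_le_norm μ))

/-- ★★ **UPPER BOUND ON THE MODULUS OF THE EIGENVALUES**: `|λ| ≤ m² + 2(d+1)c(2+ε)` on the window. [cite: Balaban1985BackgroundPropagators, Thm 3.4 p.400] -/
theorem norm_eigenvalue_le (hc : 0 ≤ c) (hm : 0 < m2) (hε : 0 ≤ ε) {U V : Tor K × Fin (d + 1) → Matrix n n 𝕜}
    (hU : ∀ b, ‖U b‖ ≤ 1 + ε) (hV : ∀ b, ‖V b‖ ≤ 1 + ε) {μ : 𝕜} {v : Tor K × n → 𝕜} (hv : v ≠ 0) (h : cxLapF K c m2 U V *ᵥ v = μ • v) :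
    ‖μ‖ ≤ m2 + 2 * ((d : ℝ) + 1) * c * (2 + ε) := by
  have hG := norm_D0_sub_eigenvalue_le K (m2 := m2) hc hε hU hV hv h
  have hD0 : 0 < m2 + 2 * ((d : ℝ) + 1) * c := by positivity
  have h1 : ‖μ‖ ≤ ‖(((m2 + 2 * ((d : ℝ) + 1) * c : ℝ) : 𝕜))‖ + ‖(((m2 + 2 * ((d : ℝ) + 1) * c : ℝ) : 𝕜)) - μ‖ := by
    have := norm_sub_le (((m2 + 2 * ((d : ℝ) + 1) * c : ℝ) : 𝕜)) ((((m2 + 2 * ((d : ℝ) + 1) * c : ℝ) : 𝕜)) - μ)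
    rwa [sub_sub_cancel] at this
  rw [RCLike.norm_ofReal, abs_of_pos hD0] at h1
  nlinarith

/-! ## §3 The determinant window (over `ℂ`) -/

/-- `a ≤ |z|` on a multiset ⟹ `a^{|s|} ≤ |Π s|` (`a ≥ 0`). [folklore] -/
private theorem pow_card_le_norm_multiset_prod (s : Multiset ℂ) {a : ℝ} (ha : 0 ≤ a) (h : ∀ z ∈ s, a ≤ ‖z‖) : a ^ Multiset.card s ≤ ‖s.prod‖ := by
  induction s using Multiset.induction_on with
  | empty => simp
  | cons z s ih =>
    rw [Multiset.prod_cons, Multiset.card_cons, norm_mul, pow_succ']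
    exact mul_le_mul (h z (Multiset.mem_cons_self _ _)) (ih fun w hw => h w (Multiset.mem_cons_of_mem hw)) (pow_nonneg ha _) (norm_nonneg _)

/-- `|z| ≤ b` on a multiset ⟹ `|Π s| ≤ b^{|s|}`. [folklore] -/
private theorem norm_multiset_prod_le_pow_card (s : Multiset ℂ) {b : ℝ} (h : ∀ z ∈ s, ‖z‖ ≤ b) : ‖s.prod‖ ≤ b ^ Multiset.card s := by
  induction s using Multiset.induction_on with
  | empty => simp
  | cons z s ih =>
    rw [Multiset.prod_cons, Multiset.card_cons, norm_mul, pow_succ']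
    exact mul_le_mul (h z (Multiset.mem_cons_self _ _)) (ih fun w hw => h w (Multiset.mem_cons_of_mem hw)) (norm_nonneg _)
      ((norm_nonneg z).trans (h z (Multiset.mem_cons_self _ _)))

/-- ★★★ **THE DETERMINANT WINDOW, LOWER HALF**: over `ℂ`, on the window `‖U(b)‖, ‖V(b)‖ ≤ 1+ε`, `2(d+1)cε < m²`,
`(m² − 2(d+1)cε)^{|T×n|} ≤ |det M_{U,V}|` — the complex Gaussian normalisation is bounded away from zero uniformly in the field (`det = Π` eigenvalues, each of modulus `≥ m′²`).
[cite: Balaban1985BackgroundPropagators, Thm 3.4 p.400; King1986, (3.89) p.668, (4.4) p.670] -/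
theorem pow_le_norm_det_cxLapF {ν : Type*} [Fintype ν] [DecidableEq ν] (hc : 0 ≤ c) (hε : 0 ≤ ε) (hwin : 2 * ((d : ℝ) + 1) * c * ε < m2)
    {U V : Tor K × Fin (d + 1) → Matrix ν ν ℂ} (hU : ∀ b, ‖U b‖ ≤ 1 + ε) (hV : ∀ b, ‖V b‖ ≤ 1 + ε) :
    (m2 - 2 * ((d : ℝ) + 1) * c * ε) ^ Fintype.card (Tor K × ν) ≤ ‖(cxLapF K c m2 U V).det‖ := by
  have hcard : Multiset.card (cxLapF K c m2 U V).charpoly.roots = Fintype.card (Tor K × ν) := by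
    rw [← (IsAlgClosed.splits (cxLapF K c m2 U V).charpoly).natDegree_eq_card_roots, Matrix.charpoly_natDegree_eq_dim]
  rw [Matrix.det_eq_prod_roots_charpoly, ← hcard]
  refine pow_card_le_norm_multiset_prod _ (shifted_mass_pos hwin).le fun z hz => ?_
  obtain ⟨v, hv, hAv⟩ := Literature.LinearAlgebra.Matrix.exists_eigenvector_of_isRoot_charpoly
    ((Polynomial.mem_roots (Matrix.charpoly_monic _).ne_zero).mp hz)
  exact shifted_mass_le_norm_eigenvalue K hc hε hU hV hv hAv

/-- ★★★ **THE DETERMINANT WINDOW, UPPER HALF**: `|det M_{U,V}| ≤ (m² + 2(d+1)c(2+ε))^{|T×n|}` on the window (over `ℂ`). [cite: Balaban1985BackgroundPropagators, Thm 3.4 p.400; King1986, (3.89) p.668] -/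
theorem norm_det_cxLapF_le_pow {ν : Type*} [Fintype ν] [DecidableEq ν] (hc : 0 ≤ c) (hm : 0 < m2) (hε : 0 ≤ ε)
    {U V : Tor K × Fin (d + 1) → Matrix ν ν ℂ} (hU : ∀ b, ‖U b‖ ≤ 1 + ε) (hV : ∀ b, ‖V b‖ ≤ 1 + ε) :
    ‖(cxLapF K c m2 U V).det‖ ≤ (m2 + 2 * ((d : ℝ) + 1) * c * (2 + ε)) ^ Fintype.card (Tor K × ν) := by
  have hcard : Multiset.card (cxLapF K c m2 U V).charpoly.roots = Fintype.card (Tor K × ν) := by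
    rw [← (IsAlgClosed.splits (cxLapF K c m2 U V).charpoly).natDegree_eq_card_roots, Matrix.charpoly_natDegree_eq_dim]
  rw [Matrix.det_eq_prod_roots_charpoly, ← hcard]
  refine norm_multiset_prod_le_pow_card _ fun z hz => ?_
  obtain ⟨v, hv, hAv⟩ := Literature.LinearAlgebra.Matrix.exists_eigenvector_of_isRoot_charpoly
    ((Polynomial.mem_roots (Matrix.charpoly_monic _).ne_zero).mp hz)
  exact norm_eigenvalue_le K hc hm hε hU hV hv hAv

/-- ★★ **PER DEGREE OF FREEDOM**: `N⁻¹·log|det M_{U,V}| ∈ [log(m² − 2(d+1)cε), log(m² + 2(d+1)c(2+ε))]`, `N = |T×n| > 0` — the complexified normalisation per site and component is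
squeezed uniformly in the volume, the fibre and the field (the non-Hermitian counterpart of PART Ͱ-c's diamagnetic window `[log det lapF∕|T|, log(m²+2(d+1)c)]`).
[cite: Balaban1985BackgroundPropagators, Thm 3.4 p.400; King1986, (3.89)–(3.93) pp.668–669] -/
theorem log_norm_det_cxLapF_div_mem {ν : Type*} [Fintype ν] [DecidableEq ν] [Nonempty ν] (hc : 0 ≤ c) (hm : 0 < m2) (hε : 0 ≤ ε)
    (hwin : 2 * ((d : ℝ) + 1) * c * ε < m2) {U V : Tor K × Fin (d + 1) → Matrix ν ν ℂ} (hU : ∀ b, ‖U b‖ ≤ 1 + ε) (hV : ∀ b, ‖V b‖ ≤ 1 + ε) :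
    (Fintype.card (Tor K × ν) : ℝ)⁻¹ * Real.log ‖(cxLapF K c m2 U V).det‖
      ∈ Set.Icc (Real.log (m2 - 2 * ((d : ℝ) + 1) * c * ε)) (Real.log (m2 + 2 * ((d : ℝ) + 1) * c * (2 + ε))) := by
  have hN : (0 : ℝ) < Fintype.card (Tor K × ν) := by exact_mod_cast Fintype.card_pos
  have hm' := shifted_mass_pos hwin
  have hlow := pow_le_norm_det_cxLapF K hc hε hwin hU hV
  have hup := norm_det_cxLapF_le_pow K hc hm hε hU hV
  have hdetpos : 0 < ‖(cxLapF K c m2 U V).det‖ := lt_of_lt_of_le (pow_pos hm' _) hlow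
  constructor
  · have h1 := Real.log_le_log (pow_pos hm' _) hlow
    rw [Real.log_pow] at h1
    rw [le_inv_mul_iff₀ hN]
    exact h1
  · have h1 := Real.log_le_log hdetpos hup
    rw [Real.log_pow] at h1
    rw [inv_mul_le_iff₀ hN]
    exact h1

end Summit.QuantumFields.YangMills.BalabanUVNodes.N15KingModelRung.Covariant

end
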